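import Summits.CriticalPhenomena.PercolationContinuityZ3.Theorems.FK.UniquenessOfEqualTheta
import Summits.CriticalPhenomena.PercolationContinuityZ3.Theorems.FK.InfiniteVolumeInvariance
import Summits.CriticalPhenomena.PercolationContinuityZ3.Theorems.FK.ClusterSizeLocality
import Literature.Probability.Percolation.MeanFieldBetaFromGamma
import Mathlib.MeasureTheory.MeasurableSpace.NCard
import HarnessLib

/-!
# FK-continuity cell, FO-10a: the CLUSTER-DENSITY criterion for uniqueness —
# `φ⁰_{p,q} = φ¹_{p,q}` iff `φ⁰_{p,q}(|C|⁻¹) = φ¹_{p,q}(|C|⁻¹)` (Grimmett 2006, Prop. (4.85) and its converse)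

Registered R81 (cell INBOX l.5913, 2026-08-23); registry row FO-10a-g337; label CRT-B (coordinator fk-4 g175).
Cell `fk-continuity` (bschramm), row FO-10a (domain-Markov + comparison layer over FO-06); support file for the
FK-continuity transplant (`--supports stmt-CriticalPhenomena-4575`); builds on p205010 (kernel theorem, internal audit
signed; external expert review pending). Pure proofs; no definitions, no named facts, no sorries; general `d`.

The number of open clusters per vertex, `κ_P(x) = P(|C_x|⁻¹)` (with `|C_x|⁻¹ = 0` when `C_x` is infinite — in Lean
`((openCluster ω x).ncard : ℝ)⁻¹`, `Set.ncard` of an infinite set being `0`), is the order parameter conjugate to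
`q` (Grimmett 2006, (4.84): `dG/dκ = d⁻¹ φ^b_{p,q}(|C_0|⁻¹)` off a countable set). Prop. (4.85): if
`φ⁰_{p,q}(|C_0|⁻¹) = φ¹_{p,q}(|C_0|⁻¹)` then `φ⁰_{p,q} = φ¹_{p,q}`. Grimmett's proof couples `φ⁰ ≤ φ¹` monotonically,
shows the vertex sets of `C_0` agree a.s. (using the a.s. uniqueness of the infinite cluster), deduces (4.88)
`φ⁰(x ↮ y) = φ¹(x ↮ y)` and then `h⁰ = h¹` by (4.38). HERE: under the monotone coupling `|C_x(ω₀)|⁻¹ ≥ |C_x(ω₁)|⁻¹`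
pointwise, so equal means force a.s. equality, in particular `{|C_x(ω₀)| = ∞} = {|C_x(ω₁)| = ∞}` a.s., i.e.
`θ⁰(p,q) = θ¹(p,q)` — and equal percolation probabilities already force `φ⁰_{p,q} = φ¹_{p,q}` (Thm. (5.16)(c),
row FO-10a-g336 `rcLimit_false_eq_rcLimit_true_of_thetaFree_eq_thetaWired`). The coupling step needs no cluster-set bookkeeping;
the a.s. uniqueness of the infinite cluster enters only through Thm. (5.16)(c).

* `antitone_inv_ncard_openCluster`, `inv_ncard_openCluster_eq_zero_iff` (`= 0 ↔ ω ∈ {x ↔ ∞}`),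
  `abs_inv_ncard_openCluster_le_one` — deterministic facts (measurability / integrability of `|C_x|⁻¹` are
  `ClusterSizeLocality.lean`'s `measurable_inv_ncard_openCluster'` / `integrable_inv_ncard_openCluster'`, imported);
* `FKGibbs.integral_inv_ncard_openCluster_le` / `FKGibbs.le_integral_inv_ncard_openCluster` —
  **`κ¹(x) ≤ κ_P(x) ≤ κ⁰(x)` for every `P` of the sandwich class** (`|C_x|⁻¹` is decreasing);
* `rcLimit_real_percolatesAt_eq_theta` — `φ^b_{p,q}(x ↔ ∞) = θ^b(p,q)` at every site (translation invariance);
* **`thetaFree_eq_thetaWired_of_integral_inv_ncard_eq`** — `κ⁰(x) = κ¹(x) ⇒ θ⁰(p,q) = θ¹(p,q)` (the coupling step);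
* HEADLINE **`rcLimit_false_eq_rcLimit_true_iff_integral_inv_ncard_eq (hp : p ∈ Icc 0 1) (hq : 1 ≤ q) (x : Site d) :
  φ⁰_{p,q} = φ¹_{p,q} ↔ ∫ |C_x|⁻¹ dφ⁰_{p,q} = ∫ |C_x|⁻¹ dφ¹_{p,q}`** — Prop. (4.85) with its (trivial) converse;
  `fkUniqueAt_iff_integral_inv_ncard_eq` (the cell's seam `FKUniqueAt d p q` read as "no jump of the cluster
  density"); `integral_inv_ncard_lt_of_rcLimit_false_ne_rcLimit_true` — at a point of phase coexistence
  `κ¹(x) < κ⁰(x)`.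

* `tendsto_rcLimit_real_clusterSizeGe`, `thetaFree_eq_thetaWired_of_eventually_real_clusterSizeGe_eq`,
  **`rcLimit_false_eq_rcLimit_true_iff_forall_real_clusterSizeGe_eq`** — the LAW of `|C_x|` version (Grimmett p. 95, first step,
  reads "the law of the vertex-set of `C_0` is the same under `φ⁰` and `φ¹`"): `φ⁰_{p,q} = φ¹_{p,q}` iff `φ⁰(|C_x| ≥ n) = φ¹(|C_x| ≥ n)`
  for all (equivalently: all large) `n` — by continuity from above along `{|C_x| ≥ n} ↓ {x ↔ ∞}`.

With rows FO-10a-g336h (`EdgeDensityContinuityCriterion` / `LatentHeatCriterion`: uniqueness iff `h⁰ = h¹`) and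
FO-10a-g336 (`UniquenessOfEqualTheta`: iff `θ⁰ = θ¹`) this completes the three order-parameter criteria of
Grimmett 2006 §4.5–§4.6 / §5.2: edge density (conjugate to `p`), cluster density (conjugate to `q`), percolation
probability. Honest framing: UNCONDITIONAL infinite-volume structure (every `d`, `q ≥ 1`, `0 ≤ p ≤ 1`); it decides
nothing about `q ∈ (1,2)` at `p_c(q)`; NOT a binder discharge, NOT `_r4`; `_r3` « 2 / 0 ☑ », n_open = 2 unchanged.

## References

* G. Grimmett, *The Random-Cluster Model*, Springer 2006 (`book:grimmett2006-random-cluster-model`): Prop. (4.85)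
  and its proof [PDF pp. 94–95]; (4.84), Thm. (4.58), Lemma (4.79) [PDF pp. 92–94]; Thm. (5.16)(c) [PDF p. 101].
  [Grimmett2006]
-/

noncomputable section

open MeasureTheory Set Filter
open scoped Topology ENNReal

namespace Summit.CriticalPhenomena.PercolationContinuityZ3.Theorems.FK

open Literature.Probability.Percolation Literature.Probability.LatticeModels Literature.Barriers.CriticalPhenomena

variable {d : ℕ}

/-! ### `|C_x|⁻¹`: deterministic facts -/

section Deterministic

variable {V : Type*}

/-- **`ω ↦ |C_x(ω)|⁻¹` is decreasing** (convention `|C_x|⁻¹ = 0` for an infinite cluster, which is Lean's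
`Set.ncard = 0` on infinite sets). [cite: Grimmett2006, proof of Lemma (4.79), p. 95 ("the decreasing function |C|⁻¹")] -/
theorem antitone_inv_ncard_openCluster (x : V) :
    Antitone fun ω : BondConfig V => ((openCluster ω x).ncard : ℝ)⁻¹ := by
  intro ω ω' h
  dsimp only
  by_cases hfin : (openCluster ω' x).Finite
  · have hsub := openCluster_mono h x
    have hpos : 0 < (openCluster ω x).ncard := (Set.ncard_pos (hfin.subset hsub)).2 ⟨x, mem_openCluster_self ω x⟩
    exact inv_anti₀ (by exact_mod_cast hpos) (by exact_mod_cast Set.ncard_le_ncard hsub hfin)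
  · rw [Set.Infinite.ncard hfin, Nat.cast_zero, inv_zero]
    positivity

/-- `|C_x(ω)|⁻¹ = 0` iff `C_x(ω)` is infinite. [folklore] -/
theorem inv_ncard_openCluster_eq_zero_iff (x : V) (ω : BondConfig V) :
    ((openCluster ω x).ncard : ℝ)⁻¹ = 0 ↔ ω ∈ percolatesAt x := by
  rw [inv_eq_zero, Nat.cast_eq_zero, percolatesAt, Set.mem_setOf_eq]
  by_cases hfin : (openCluster ω x).Finite
  · rw [Set.ncard_eq_zero hfin]
    exact ⟨fun h => absurd (mem_openCluster_self ω x) (by rw [h]; exact notMem_empty x),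
      fun h => absurd hfin h⟩
  · exact ⟨fun _ => hfin, fun _ => Set.Infinite.ncard hfin⟩

/-- `0 ≤ |C_x|⁻¹ ≤ 1`. [folklore] -/
theorem abs_inv_ncard_openCluster_le_one (x : V) (ω : BondConfig V) :
    |((openCluster ω x).ncard : ℝ)⁻¹| ≤ 1 := by
  rw [abs_of_nonneg (inv_nonneg.2 (Nat.cast_nonneg _))]
  exact Nat.cast_inv_le_one _

end Deterministic

/-! ### `κ¹ ≤ κ_P ≤ κ⁰` on the sandwich class -/

section Sandwich

variable {p q : ℝ} {P : Measure (BondConfig (Site d))}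

/-- **`κ_P(x) ≤ κ⁰(x)`**: `∫ |C_x|⁻¹ dP ≤ ∫ |C_x|⁻¹ dφ⁰_{p,q}` for every `P` of the sandwich class (`0 ≤ p ≤ 1`,
`q ≥ 1`) — `|C_x|⁻¹` is a bounded decreasing functional and `φ⁰_{p,q} ≤st P`.
[cite: Grimmett2006, Thm. (4.34)(b) eq. (4.35) with §2.1; proof of Lemma (4.79), p. 95] -/
theorem FKGibbs.integral_inv_ncard_openCluster_le (hP : FKGibbs d p q P) (hp : p ∈ Set.Icc (0 : ℝ) 1) (hq : 1 ≤ q)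
    (x : Site d) :
    ∫ ω, ((openCluster ω x).ncard : ℝ)⁻¹ ∂P ≤ ∫ ω, ((openCluster ω x).ncard : ℝ)⁻¹ ∂(rcLimit d false p q) := by
  have h := hP.integral_rcLimit_false_le hp hq (antitone_inv_ncard_openCluster x).neg
    (measurable_inv_ncard_openCluster' x).neg (C := 1)
    (fun ω => by rw [abs_neg]; exact abs_inv_ncard_openCluster_le_one x ω)
  rw [integral_neg, integral_neg] at h
  exact neg_le_neg_iff.1 h

/-- **`κ¹(x) ≤ κ_P(x)`**: `∫ |C_x|⁻¹ dφ¹_{p,q} ≤ ∫ |C_x|⁻¹ dP` for every `P` of the sandwich class.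
[cite: Grimmett2006, Thm. (4.34)(b) eq. (4.35) with §2.1; proof of Lemma (4.79), p. 95] -/
theorem FKGibbs.le_integral_inv_ncard_openCluster (hP : FKGibbs d p q P) (hp : p ∈ Set.Icc (0 : ℝ) 1) (hq : 1 ≤ q)
    (x : Site d) :
    ∫ ω, ((openCluster ω x).ncard : ℝ)⁻¹ ∂(rcLimit d true p q) ≤ ∫ ω, ((openCluster ω x).ncard : ℝ)⁻¹ ∂P := by
  have h := hP.integral_le_rcLimit_true hp hq (antitone_inv_ncard_openCluster x).neg
    (measurable_inv_ncard_openCluster' x).neg (C := 1)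
    (fun ω => by rw [abs_neg]; exact abs_inv_ncard_openCluster_le_one x ω)
  rw [integral_neg, integral_neg] at h
  exact neg_le_neg_iff.1 h

/-- In particular `κ¹(x) ≤ κ⁰(x)`. [cite: Grimmett2006, proof of Lemma (4.79), p. 95] -/
theorem integral_inv_ncard_openCluster_true_le_false (hp : p ∈ Set.Icc (0 : ℝ) 1) (hq : 1 ≤ q) (x : Site d) :
    ∫ ω, ((openCluster ω x).ncard : ℝ)⁻¹ ∂(rcLimit d true p q) ≤
      ∫ ω, ((openCluster ω x).ncard : ℝ)⁻¹ ∂(rcLimit d false p q) :=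
  ((isBoxLimit_rcLimit true hp hq).fkGibbs hp hq).integral_inv_ncard_openCluster_le hp hq x

end Sandwich

/-! ### `κ⁰(x) = κ¹(x)` forces `θ⁰ = θ¹` (the coupling step) -/

section Coupling

variable {p q : ℝ}

/-- **`φ^b_{p,q}(x ↔ ∞) = θ^b(p,q)` at every site `x`** (translation invariance of the canonical limits).
[cite: Grimmett2006, Thm. (4.19)(b) and §5.1 (5.1)] -/
theorem rcLimit_real_percolatesAt_eq_theta (b : Bool) (hp : p ∈ Set.Icc (0 : ℝ) 1) (hq : 1 ≤ q) (x : Site d) :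
    (rcLimit d b p q).real (percolatesAt x) = (bif b then thetaWired d p q else thetaFree d p q) := by
  rw [real_percolatesAt_eq_map_shift (rcLimit d b p q) x, rcLimit_map_relabel_shift b hp hq (-x)]
  exact rcLimit_real_percolatesAt b hp hq

/-- **The coupling step of Prop. (4.85), short-circuited: equal cluster densities at one site force equal
percolation probabilities, `κ⁰(x) = κ¹(x) ⇒ φ⁰_{p,q}(x ↔ ∞) = φ¹_{p,q}(x ↔ ∞)`** (`0 ≤ p ≤ 1`, `q ≥ 1`). Under the
monotone coupling `π` of `(φ⁰_{p,q}, φ¹_{p,q})` (`ω₀ ⊆ ω₁` a.s.), `|C_x(ω₀)|⁻¹ - |C_x(ω₁)|⁻¹ ≥ 0` has integral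
`κ⁰(x) - κ¹(x) = 0`, so it vanishes a.s.; and `|C_x|⁻¹ = 0` exactly on `{x ↔ ∞}`.
[cite: Grimmett2006, Prop. (4.85), proof, first step (pp. 94–95)] -/
theorem rcLimit_real_percolatesAt_eq_of_integral_inv_ncard_eq (hp : p ∈ Set.Icc (0 : ℝ) 1) (hq : 1 ≤ q)
    (x : Site d)
    (h : ∫ ω, ((openCluster ω x).ncard : ℝ)⁻¹ ∂(rcLimit d false p q) =
      ∫ ω, ((openCluster ω x).ncard : ℝ)⁻¹ ∂(rcLimit d true p q)) :
    (rcLimit d false p q).real (percolatesAt x) = (rcLimit d true p q).real (percolatesAt x) := by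
  obtain ⟨π, hπ, h0, h1, hle⟩ := exists_monotoneCoupling_rcLimit_false_true (d := d) hp hq
  set f : BondConfig (Site d) → ℝ := fun ω => ((openCluster ω x).ncard : ℝ)⁻¹ with hf
  have hfm : Measurable f := measurable_inv_ncard_openCluster' x
  -- the two marginal integrals
  have i0 : ∫ z, f z.1 ∂π = ∫ ω, f ω ∂(rcLimit d false p q) := by
    rw [← h0, integral_map measurable_fst.aemeasurable hfm.aestronglyMeasurable]
  have i1 : ∫ z, f z.2 ∂π = ∫ ω, f ω ∂(rcLimit d true p q) := by
    rw [← h1, integral_map measurable_snd.aemeasurable hfm.aestronglyMeasurable]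
  have hint0 : Integrable (fun z : BondConfig (Site d) × BondConfig (Site d) => f z.1) π :=
    Integrable.of_bound (hfm.comp measurable_fst).aestronglyMeasurable 1
      (Eventually.of_forall fun z => by rw [Real.norm_eq_abs]; exact abs_inv_ncard_openCluster_le_one x z.1)
  have hint1 : Integrable (fun z : BondConfig (Site d) × BondConfig (Site d) => f z.2) π :=
    Integrable.of_bound (hfm.comp measurable_snd).aestronglyMeasurable 1
      (Eventually.of_forall fun z => by rw [Real.norm_eq_abs]; exact abs_inv_ncard_openCluster_le_one x z.2)
  -- the nonnegative difference has integral zero, hence vanishes a.s.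
  have hnonneg : 0 ≤ᵐ[π] fun z => f z.1 - f z.2 :=
    hle.mono fun z hz => sub_nonneg.2 (antitone_inv_ncard_openCluster x hz)
  have hzero : ∫ z, (f z.1 - f z.2) ∂π = 0 := by
    rw [integral_sub hint0 hint1, i0, i1, h, sub_self]
  have hae : (fun z => f z.1 - f z.2) =ᵐ[π] 0 :=
    (integral_eq_zero_iff_of_nonneg_ae hnonneg (hint0.sub hint1)).1 hzero
  -- so `{ω₀ ∈ I_x}` and `{ω₁ ∈ I_x}` agree a.s.
  have hset : (Prod.fst ⁻¹' percolatesAt x : Set (BondConfig (Site d) × BondConfig (Site d))) =ᵐ[π]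
      (Prod.snd ⁻¹' percolatesAt x : Set (BondConfig (Site d) × BondConfig (Site d))) := by
    filter_upwards [hae] with z hz
    have hz' : f z.1 = f z.2 := sub_eq_zero.1 hz
    change (z.1 ∈ percolatesAt x) = (z.2 ∈ percolatesAt x)
    rw [← inv_ncard_openCluster_eq_zero_iff x z.1, ← inv_ncard_openCluster_eq_zero_iff x z.2]
    change (f z.1 = 0) = (f z.2 = 0)
    rw [hz']
  have hm : MeasurableSet (percolatesAt x : Set (BondConfig (Site d))) := measurableSet_percolatesAt_holds x
  simp only [measureReal_def]
  rw [← h0, ← h1, Measure.map_apply measurable_fst hm, Measure.map_apply measurable_snd hm, measure_congr hset]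

/-- **`κ⁰(x) = κ¹(x) ⇒ θ⁰(p,q) = θ¹(p,q)`** (`0 ≤ p ≤ 1`, `q ≥ 1`, any site `x`).
[cite: Grimmett2006, Prop. (4.85), proof, first step (pp. 94–95)] -/
theorem thetaFree_eq_thetaWired_of_integral_inv_ncard_eq (hp : p ∈ Set.Icc (0 : ℝ) 1) (hq : 1 ≤ q) (x : Site d)
    (h : ∫ ω, ((openCluster ω x).ncard : ℝ)⁻¹ ∂(rcLimit d false p q) =
      ∫ ω, ((openCluster ω x).ncard : ℝ)⁻¹ ∂(rcLimit d true p q)) :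
    thetaFree d p q = thetaWired d p q := by
  have h' := rcLimit_real_percolatesAt_eq_of_integral_inv_ncard_eq hp hq x h
  rwa [rcLimit_real_percolatesAt_eq_theta false hp hq x, rcLimit_real_percolatesAt_eq_theta true hp hq x] at h'

end Coupling

/-! ### The criterion -/

section Criterion

variable {p q : ℝ}

/-- **Grimmett 2006, Prop. (4.85) with its converse — the cluster-density criterion for uniqueness:
`φ⁰_{p,q} = φ¹_{p,q}` iff `φ⁰_{p,q}(|C_x|⁻¹) = φ¹_{p,q}(|C_x|⁻¹)`** (`0 ≤ p ≤ 1`, `q ≥ 1`, every `d`, any site `x`).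
(⇐): equal cluster densities force `θ⁰ = θ¹` (coupling step) and hence `φ⁰ = φ¹` (Thm. (5.16)(c), row FO-10a-g336).
[cite: Grimmett2006, Prop. (4.85); Thm. (5.16)(c)] -/
theorem rcLimit_false_eq_rcLimit_true_iff_integral_inv_ncard_eq (hp : p ∈ Set.Icc (0 : ℝ) 1) (hq : 1 ≤ q)
    (x : Site d) :
    rcLimit d false p q = rcLimit d true p q ↔
      ∫ ω, ((openCluster ω x).ncard : ℝ)⁻¹ ∂(rcLimit d false p q) =
        ∫ ω, ((openCluster ω x).ncard : ℝ)⁻¹ ∂(rcLimit d true p q) :=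
  ⟨fun h => by rw [h], fun h => rcLimit_false_eq_rcLimit_true_of_thetaFree_eq_thetaWired hp hq
    (thetaFree_eq_thetaWired_of_integral_inv_ncard_eq hp hq x h)⟩

/-- **The boundary-condition seam read as "no jump of the cluster density"**:
`FKUniqueAt d p q ↔ κ⁰(x) = κ¹(x)`. [cite: Grimmett2006, Prop. (4.85); Thm. (5.16)(c)] -/
theorem fkUniqueAt_iff_integral_inv_ncard_eq (hp : p ∈ Set.Icc (0 : ℝ) 1) (hq : 1 ≤ q) (x : Site d) :
    FKUniqueAt d p q ↔
      ∫ ω, ((openCluster ω x).ncard : ℝ)⁻¹ ∂(rcLimit d false p q) =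
        ∫ ω, ((openCluster ω x).ncard : ℝ)⁻¹ ∂(rcLimit d true p q) := by
  rw [fkUniqueAt_iff_rcLimit_false_eq_rcLimit_true hp hq, rcLimit_false_eq_rcLimit_true_iff_integral_inv_ncard_eq hp hq x]

/-- **At a point of phase coexistence the cluster density JUMPS: `κ¹(x) < κ⁰(x)`** at every site.
[cite: Grimmett2006, Prop. (4.85); Thm. (5.16)(c)] -/
theorem integral_inv_ncard_lt_of_rcLimit_false_ne_rcLimit_true (hp : p ∈ Set.Icc (0 : ℝ) 1) (hq : 1 ≤ q)
    (hne : rcLimit d false p q ≠ rcLimit d true p q) (x : Site d) :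
    ∫ ω, ((openCluster ω x).ncard : ℝ)⁻¹ ∂(rcLimit d true p q) <
      ∫ ω, ((openCluster ω x).ncard : ℝ)⁻¹ ∂(rcLimit d false p q) :=
  lt_of_le_of_ne (integral_inv_ncard_openCluster_true_le_false hp hq x)
    (fun h => hne ((rcLimit_false_eq_rcLimit_true_iff_integral_inv_ncard_eq hp hq x).2 h.symm))

/-- **Every measure of the sandwich class has the cluster density of `φ⁰_{p,q}` when `κ⁰(x) = κ¹(x)`** — indeed the
class is then `{φ⁰_{p,q}}`. [cite: Grimmett2006, Prop. (4.85); Thm. (5.16)(c) with Thm. (4.34) eq. (4.36)] -/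
theorem FKGibbs.eq_rcLimit_false_of_integral_inv_ncard_eq {P : Measure (BondConfig (Site d))} (hP : FKGibbs d p q P)
    (hp : p ∈ Set.Icc (0 : ℝ) 1) (hq : 1 ≤ q) (x : Site d)
    (h : ∫ ω, ((openCluster ω x).ncard : ℝ)⁻¹ ∂(rcLimit d false p q) =
      ∫ ω, ((openCluster ω x).ncard : ℝ)⁻¹ ∂(rcLimit d true p q)) :
    P = rcLimit d false p q :=
  hP.eq_rcLimit_false_of_fkUniqueAt hp hq ((fkUniqueAt_iff_integral_inv_ncard_eq hp hq x).2 h)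

end Criterion

/-! ### The law of `|C_x|` -/

section ClusterSizeLaw

variable {p q : ℝ}

/-- **`φ^b_{p,q}(|C_x| ≥ n) → φ^b_{p,q}(x ↔ ∞)`** as `n → ∞` (continuity from above along the decreasing events
`{|C_x| ≥ n}`, whose intersection is `{x ↔ ∞}`). [cite: Grimmett2006, §5.1 (5.1); proof of Prop. (4.85), first step, p. 95] -/
theorem tendsto_rcLimit_real_clusterSizeGe (b : Bool) (p q : ℝ) (x : Site d) :
    Tendsto (fun n => (rcLimit d b p q).real (clusterSizeGe x n)) atTop
      (𝓝 ((rcLimit d b p q).real (percolatesAt x))) := by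
  haveI := isProbabilityMeasure_rcLimit b p q (d := d)
  rw [← iInter_clusterSizeGe]
  exact tendsto_measureReal_iInter_of_antitone _ (clusterSizeGe_antitone x) (measurableSet_clusterSizeGe x)

/-- **Eventually-equal cluster-size distributions force `θ⁰ = θ¹`**: if `φ⁰_{p,q}(|C_x| ≥ n) = φ¹_{p,q}(|C_x| ≥ n)` for
all large `n`, then `θ⁰(p,q) = θ¹(p,q)` (`0 ≤ p ≤ 1`, `q ≥ 1`). [cite: Grimmett2006, proof of Prop. (4.85), first step, p. 95; §5.1 (5.1)] -/
theorem thetaFree_eq_thetaWired_of_eventually_real_clusterSizeGe_eq (hp : p ∈ Set.Icc (0 : ℝ) 1) (hq : 1 ≤ q)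
    (x : Site d)
    (h : ∀ᶠ n in atTop, (rcLimit d false p q).real (clusterSizeGe x n) = (rcLimit d true p q).real (clusterSizeGe x n)) :
    thetaFree d p q = thetaWired d p q := by
  have h0 := (tendsto_rcLimit_real_clusterSizeGe false p q x).congr' h
  have h01 := tendsto_nhds_unique h0 (tendsto_rcLimit_real_clusterSizeGe true p q x)
  rwa [rcLimit_real_percolatesAt_eq_theta false hp hq x, rcLimit_real_percolatesAt_eq_theta true hp hq x] at h01

/-- **Uniqueness iff the cluster-size distributions agree: `φ⁰_{p,q} = φ¹_{p,q}` iff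
`φ⁰_{p,q}(|C_x| ≥ n) = φ¹_{p,q}(|C_x| ≥ n)` for every `n`** (`0 ≤ p ≤ 1`, `q ≥ 1`, any site `x`; Grimmett's first step of
the proof of Prop. (4.85) — "the law of the vertex-set of `C_0` is the same under `φ⁰_{p,q}` and `φ¹_{p,q}`" — read on `|C_0|`
and closed by Thm. (5.16)(c)). [cite: Grimmett2006, proof of Prop. (4.85), first step, p. 95; Thm. (5.16)(c)] -/
theorem rcLimit_false_eq_rcLimit_true_iff_forall_real_clusterSizeGe_eq (hp : p ∈ Set.Icc (0 : ℝ) 1) (hq : 1 ≤ q)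
    (x : Site d) :
    rcLimit d false p q = rcLimit d true p q ↔
      ∀ n, (rcLimit d false p q).real (clusterSizeGe x n) = (rcLimit d true p q).real (clusterSizeGe x n) :=
  ⟨fun h n => by rw [h], fun h => rcLimit_false_eq_rcLimit_true_of_thetaFree_eq_thetaWired hp hq
    (thetaFree_eq_thetaWired_of_eventually_real_clusterSizeGe_eq hp hq x (Eventually.of_forall h))⟩

/-- **At a point of phase coexistence the cluster-size distributions differ at ALL large sizes**:
`φ⁰_{p,q}(|C_x| ≥ n) < φ¹_{p,q}(|C_x| ≥ n)` frequently — indeed for all large `n`, since `{|C_x| ≥ n}` is increasing and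
eventual equality would force `θ⁰ = θ¹`. [cite: Grimmett2006, proof of Prop. (4.85), first step, p. 95; Thm. (5.16)(c)] -/
theorem frequently_real_clusterSizeGe_lt_of_rcLimit_false_ne_rcLimit_true (hp : p ∈ Set.Icc (0 : ℝ) 1) (hq : 1 ≤ q)
    (hne : rcLimit d false p q ≠ rcLimit d true p q) (x : Site d) :
    ∃ᶠ n in atTop, (rcLimit d false p q).real (clusterSizeGe x n) < (rcLimit d true p q).real (clusterSizeGe x n) := by
  by_contra hcon
  rw [Filter.not_frequently] at hcon
  refine hne (rcLimit_false_eq_rcLimit_true_of_thetaFree_eq_thetaWired hp hq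
    (thetaFree_eq_thetaWired_of_eventually_real_clusterSizeGe_eq hp hq x (hcon.mono fun n hn => ?_)))
  exact le_antisymm (((isBoxLimit_rcLimit true hp hq).fkGibbs hp hq).rcLimit_false_real_le_of_measurableSet hp hq
    (fun _ _ h hω => le_trans (mem_clusterSizeGe.1 hω) (Set.encard_le_encard (openCluster_mono h x)))
    (measurableSet_clusterSizeGe x n)) (not_lt.1 hn)

end ClusterSizeLaw

end Summit.CriticalPhenomena.PercolationContinuityZ3.Theorems.FK

end
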